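import Literature.Computability.Complexity.StructuralPH
import Literature.Computability.Complexity.NPClosureProofs
import Literature.Computability.Complexity.KannanLanguage
import Literature.Computability.Complexity.KarpLipton
import Literature.Computability.Complexity.BakerGillSolovayRecursive
import Literature.Computability.Complexity.BakerGillSolovayRecursiveB
import HarnessLib

/-!
# Kannan's theorem from Karp–Lipton and the `Σ₄` lower bound (proofs; trunk CplxCore, pnp.S16)

This file begins the discharge (D-0014) of the named fact `Literature.Computability.Complexity.kannan` (`StructuralPH.lean`;
Kannan 1982, Thm. 2: "for any nonnegative integer `k`, there is a language `L_k` in `Σ₂ᵖ ∩ Π₂ᵖ`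
such that `L_k` does not have `O(n^k)`-size circuits"). Kannan's printed proof of Theorem 2
(Inform. Control 55 (1982), p. 44) is a two-case argument from two inputs:

* **Theorem 1** (Karp–Lipton–Sipser; Karp–Lipton 1980, Thm. 6.1): if `NP` has small circuits then
  `Σₖᵖ = Σ₂ᵖ` for all `k ≥ 2` — vendored as the named fact `Literature.Computability.Complexity.karp_lipton`
  (`NP ⊆ P/poly → PH = Σ₂ᵖ`);
* **Lemma 1** (Kannan 1982, p. 43): for each `k` there is `L_k ∈ Σ₄ᵖ ∩ Π₄ᵖ` without `O(n^k)`-size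
  circuits (a `Σ₄` machine guessing the least hard circuit; counting Lemma 0).

"Case 1. `NP` has small circuits: by Theorem 1, `L_k` of Lemma 1 is in `Σ₂` (because `Σ₄ = Σ₂`)
and so also is its complement. Case 2. `NP` does not have small circuits: there is `L ∈ NP` that
does not have `O(n^k)`-size circuits for any `k`; `L` is of course in `Σ₂ ∩ Π₂`." This file PROVES
exactly this reduction, sorry-free, with the two inputs as hypotheses in the D-0014 style:

* `Literature.Computability.Complexity.kannan_of_karp_lipton`: `karp_lipton → (∀ k, ∃ L ∈ Σ₄ᵖ, L ∉ SIZE(O(n^k))) → kannan`.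
  Only the `Σ₄ᵖ` half of Lemma 1 is consumed (in Case 1, `L ∈ Π₂ᵖ` follows from `Lᶜ ∈ Π₄ᵖ ⊆ PH`).

together with the hierarchy plumbing it needs (all from discharged facts of `PolyHierarchy.lean`
in `NPClosureProofs.lean`): `NP ⊆ Σ₂ᵖ ∩ Π₂ᵖ`, `PH = Σ₂ᵖ → PH ⊆ Σ₂ᵖ ∩ Π₂ᵖ`,
`SIZE(c·n^k + c) ⊆ P/poly`.

Status of the inputs: the `Σ₄ᵖ` half of Lemma 1 is proved in `KannanLanguage.lean` (the diagonal
language `Kannan.lang k`, its circuit lower bound by counting over circuit descriptions, and its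
`Σ₄` sentence with a polynomial-time matrix: `Kannan.exists_mem_SigmaP_four_not_mem_SIZE`), so
`kannan` follows from `karp_lipton` alone (`kannan_of_karp_lipton'` below); `karp_lipton` is
discharged in `KarpLipton.lean` (`Literature.Computability.Complexity.karp_lipton_holds`), with which `kannan_holds` is
assembled.

Appended (pnp.S17): the discharge `baker_gill_solovay_eq_holds` of the named fact
`baker_gill_solovay_eq` (`StructuralPH.lean`; Baker–Gill–Solovay 1975, Thm. 1: a *recursive*
oracle `A` with `P^A = NP^A`), re-exporting `BGS.exists_computable_oracle_PRel_eq_NPRel`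
(`BakerGillSolovayRecursive.lean`: Ko's fixed point `A = K(A)` over the uniformly primitive
recursive enumeration `UnivTM2.stdEnum` of oracle algorithms is recursive, and `NP^A ⊆ P^A`).

Appended (pnp.S17, second half): the discharge `baker_gill_solovay_ne_holds` of the named fact
`baker_gill_solovay_ne` (`StructuralPH.lean`; Baker–Gill–Solovay 1975, Thm. 3: a *recursive*
oracle `B` with `P^B ≠ NP^B`; Homer–Selman 2011, Thm. 7.19: "there exists a decidable set `A` such
that `NP^A ≠ P^A`"), re-exporting `BGS.exists_computable_oracle_PRel_ne_NPRel`
(`BakerGillSolovayRecursiveB.lean`: the diagonalizing stage construction with the least choices of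
Homer–Selman over the uniformly primitive recursive enumeration `BGS.stdPairEnum` of all
(oracle algorithm, polynomial clock) pairs is computable, membership of a string being settled at
the stage after its length, and `U_B ∈ NP^B ∖ P^B`).

## References

* T. Baker, J. Gill, R. Solovay, *Relativizations of the P =? NP question*, SIAM J. Comput. 4
  (1975) 431–442, Thm. 1; S. Homer, A. L. Selman, *Computability and Complexity Theory*, 2nd ed.
  (2011), Thm. 7.18.
* (second half of pnp.S17) the same, Thm. 3 (a recursive `B` with `P^B ≠ NP^B`); Homer–Selman 2011,
  §7.5.1.1, Thm. 7.19 (pp. 161–162: the decidable `A` with `NP^A ≠ P^A`, stage construction by least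
  choices).
* R. Kannan, *Circuit-size lower bounds and non-reducibility to sparse sets*, Inform. Control 55
  (1982) 40–56, Lemma 1 (p. 43), Thm. 1 (p. 43), Thm. 2 and its proof (p. 44).
  doi:10.1016/S0019-9958(82)90382-5
* R. M. Karp, R. J. Lipton, *Some connections between nonuniform and uniform complexity classes*,
  STOC 1980, Thm. 6.1.
* S. Arora, B. Barak, *Computational Complexity: A Modern Approach*, CUP 2009, Def. 5.3,
  Thm. 5.4 (collapse), Thm. 6.19 (Karp–Lipton), Def. 6.5.
-/

namespace Literature.Computability.Complexity

open Nondeterministic Polynomial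

/-! ### Hierarchy plumbing -/

/-- `L ∈ Πₖᵖ ↔ Lᶜ ∈ Σₖᵖ` (definitional: `Πₖ = coΣₖ`). [Arora–Barak 2009, Def. 5.3] [cite: AroraBarakCC2009, Def. 5.3] -/
theorem mem_PiP_iff_compl_mem_SigmaP {k : ℕ} {L : Language Bool} : L ∈ PiP k ↔ Lᶜ ∈ SigmaP k :=
  Iff.rfl

/-- `Lᶜ ∈ Πₖᵖ ↔ L ∈ Σₖᵖ`. [Arora–Barak 2009, Def. 5.3] [cite: AroraBarakCC2009, Def. 5.3] -/
theorem compl_mem_PiP_iff {k : ℕ} {L : Language Bool} : Lᶜ ∈ PiP k ↔ L ∈ SigmaP k := by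
  rw [mem_PiP_iff_compl_mem_SigmaP, compl_compl]

/-- `Πₖᵖ ⊆ PH` (`Πₖ ⊆ Σₖ₊₁ ⊆ PH`). [Arora–Barak 2009, Def. 5.3, Thm. 5.4] [cite: AroraBarakCC2009, Def. 5.3] -/
theorem PiP_subset_PH (k : ℕ) : PiP k ⊆ PH :=
  (PiP_subset_SigmaP_succ_holds k).trans (SigmaP_subset_PH (k + 1))

/-- `PH` is closed under complement: `L ∈ PH → Lᶜ ∈ PH` (`Σₖ ∋ L ⇒ Lᶜ ∈ Πₖ ⊆ Σₖ₊₁`).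
[Arora–Barak 2009, Def. 5.3 ("PH = ∪ Σᵢ = ∪ Πᵢ")] [cite: AroraBarakCC2009, Def. 5.3] -/
theorem compl_mem_PH {L : Language Bool} (hL : L ∈ PH) : Lᶜ ∈ PH := by
  obtain ⟨k, hk⟩ := Set.mem_iUnion.1 hL
  exact PiP_subset_PH k (compl_mem_PiP_iff.2 hk)

/-- **Collapse bookkeeping**: if `PH = Σ₂ᵖ` then `PH ⊆ Σ₂ᵖ ∩ Π₂ᵖ` (for `L ∈ PH`, also `Lᶜ ∈ PH = Σ₂ᵖ`,
i.e. `L ∈ Π₂ᵖ`). This is the use of "`Σ₄ = Σ₂`, and so also is its complement" in Kannan's Case 1.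
[Kannan 1982, proof of Thm. 2, Case 1; Arora–Barak 2009, Thm. 5.4] [cite: Kannan1982, Thm. 2 (proof, Case 1)] -/
theorem PH_subset_SigmaP_two_inter_PiP_two (h : PH = SigmaP 2) : PH ⊆ SigmaP 2 ∩ PiP 2 := by
  intro L hL
  refine ⟨h ▸ hL, ?_⟩
  rw [mem_PiP_iff_compl_mem_SigmaP, ← h]
  exact compl_mem_PH hL

/-- `NP ⊆ Σ₂ᵖ ∩ Π₂ᵖ` (`NP = Σ₁ ⊆ Σ₂`, and `L ∈ NP = Σ₁ ⇒ Lᶜ ∈ Π₁ ⊆ Σ₂`). This is "`L` is of course in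
`Σ₂ ∩ Π₂`" of Kannan's Case 2. [Kannan 1982, proof of Thm. 2, Case 2; Arora–Barak 2009, Def. 5.3]
[cite: Kannan1982, Thm. 2 (proof, Case 2)] -/
theorem NP_subset_SigmaP_two_inter_PiP_two : NP ⊆ SigmaP 2 ∩ PiP 2 := by
  intro L hL
  rw [← SigmaP_one_holds] at hL
  exact ⟨SigmaP_subset_succ_holds 1 hL,
    (PiP_subset_SigmaP_succ_holds 1 : PiP 1 ⊆ SigmaP 2) (compl_mem_PiP_iff.2 hL)⟩

/-- `SIZE(c·n^k + c) ⊆ P/poly` (the bound is the polynomial `C c * X ^ k + C c`).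
[Arora–Barak 2009, Def. 6.5] [cite: AroraBarakCC2009, Def. 6.5] -/
theorem SIZE_mul_pow_add_subset_PPoly (c k : ℕ) : SIZE (fun n => c * n ^ k + c) ⊆ PPoly :=
  SIZE_subset_PPoly (C c * X ^ k + C c) fun n => by simp

/-- "NP does not have small circuits" gives, for every `k`, a language of `NP` outside
`⋃_c SIZE(c·n^k + c)`. [Kannan 1982, proof of Thm. 2, Case 2] [cite: Kannan1982, Thm. 2 (proof, Case 2)] -/
theorem exists_mem_NP_not_mem_SIZE_of_not_subset (h : ¬ NP ⊆ PPoly) (k : ℕ) :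
    ∃ L ∈ NP, L ∉ ⋃ c : ℕ, SIZE (fun n => c * n ^ k + c) := by
  obtain ⟨L, hL, hLP⟩ := Set.not_subset.1 h
  refine ⟨L, hL, fun hs => hLP ?_⟩
  obtain ⟨c, hc⟩ := Set.mem_iUnion.1 hs
  exact SIZE_mul_pow_add_subset_PPoly c k hc

/-! ### Theorem 2 from Theorem 1 and (the `Σ₄` half of) Lemma 1 -/

/-- **Kannan's Theorem 2 from its two inputs** (Kannan 1982, p. 44, the printed proof verbatim).
Given the Karp–Lipton–Sipser theorem `karp_lipton : NP ⊆ P/poly → PH = Σ₂ᵖ` (Kannan's Thm. 1) and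
the `Σ₄ᵖ` half of Kannan's Lemma 1 (for every `k` some `L ∈ Σ₄ᵖ` lies outside `SIZE(c·n^k + c)` for
every `c`), every `k` admits `L ∈ Σ₂ᵖ ∩ Π₂ᵖ` outside `⋃_c SIZE(c·n^k + c)`.
Case 1 (`NP ⊆ P/poly`): `PH = Σ₂ᵖ`, so the `Σ₄ᵖ` language and its complement are in `Σ₂ᵖ`.
Case 2 (`NP ⊄ P/poly`): some `L ∈ NP ⊆ Σ₂ᵖ ∩ Π₂ᵖ` is outside `P/poly ⊇ SIZE(c·n^k + c)`.
[cite: Kannan1982, Thm. 2 (proof)] -/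
theorem kannan_of_karp_lipton (hKL : karp_lipton)
    (h₄ : ∀ k : ℕ, ∃ L ∈ SigmaP 4, L ∉ ⋃ c : ℕ, SIZE (fun n => c * n ^ k + c)) : kannan := by
  intro k
  by_cases hNP : NP ⊆ PPoly
  · obtain ⟨L, hL₄, hLs⟩ := h₄ k
    exact ⟨L, PH_subset_SigmaP_two_inter_PiP_two (hKL hNP) (SigmaP_subset_PH 4 hL₄), hLs⟩
  · obtain ⟨L, hL, hLs⟩ := exists_mem_NP_not_mem_SIZE_of_not_subset hNP k
    exact ⟨L, NP_subset_SigmaP_two_inter_PiP_two hL, hLs⟩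

/-- The same with Lemma 1 as printed (`Σ₄ᵖ ∩ Π₄ᵖ`): the `Π₄ᵖ` half is simply dropped.
[cite: Kannan1982, Thm. 2 (proof)] -/
theorem kannan_of_karp_lipton_of_sigma_four_inter_pi_four (hKL : karp_lipton)
    (h₁ : ∀ k : ℕ, ∃ L ∈ SigmaP 4 ∩ PiP 4, L ∉ ⋃ c : ℕ, SIZE (fun n => c * n ^ k + c)) : kannan :=
  kannan_of_karp_lipton hKL fun k => by
    obtain ⟨L, hL, hLs⟩ := h₁ k
    exact ⟨L, hL.1, hLs⟩

/-! ### Theorem 2 from Theorem 1 alone -/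

/-- **Kannan's Theorem 2 from the Karp–Lipton theorem alone**: the `Σ₄ᵖ` half of Lemma 1 is the
theorem `Kannan.exists_mem_SigmaP_four_not_mem_SIZE` of `KannanLanguage.lean`.
[cite: Kannan1982, Thm. 2 (proof)] -/
theorem kannan_of_karp_lipton' (hKL : karp_lipton) : kannan :=
  kannan_of_karp_lipton hKL Kannan.exists_mem_SigmaP_four_not_mem_SIZE

/-! ### The discharge of pnp.S16 -/

/-- **Discharge of `kannan`** (pnp.S16; Kannan 1982, Thm. 2: "for any nonnegative integer `k`,
there is a language `L_k` in `Σ₂ᵖ ∩ Π₂ᵖ` such that `L_k` does not have `O(n^k)`-size circuits"):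
Kannan's two-case proof (`kannan_of_karp_lipton`) fed with the Karp–Lipton theorem
(`karp_lipton_holds`, `KarpLipton.lean`) and the `Σ₄ᵖ` half of his Lemma 1
(`Kannan.exists_mem_SigmaP_four_not_mem_SIZE`, `KannanLanguage.lean`). Axioms: `propext`,
`Classical.choice`, `Quot.sound`. [cite: Kannan1982, Thm. 2] -/
theorem kannan_holds : kannan :=
  kannan_of_karp_lipton' karp_lipton_holds

/-! ### The discharge of pnp.S17 (first half) -/

/-- **Discharge of `baker_gill_solovay_eq`** (pnp.S17, first half; Baker–Gill–Solovay 1975,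
Thm. 1: "there is a recursive oracle `A` with `P^A = NP^A`"; Homer–Selman 2011, Thm. 7.18). The
oracle is Ko's fixed point `A = K(A)` (`BGS.oracleA`, `BakerGillSolovay.lean`) over the standard
enumeration `UnivTM2.stdEnum` of oracle algorithms — clocked standard `TM2` machines run by a
primitive recursive interpreter (`UniversalTM2.lean`, `OracleAlgEnumeration.lean`): the
enumeration contains every polynomial-time oracle algorithm, so `NP^A ⊆ P^A`
(`BGS.NPRel_oracleA_subset`), and it is uniformly primitive recursive, so `A` is recursive
(`BGS.computablePred_mem_oracleA`, `BakerGillSolovayRecursive.lean`). Axioms: `propext`,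
`Classical.choice`, `Quot.sound`. [cite: BakerGillSolovay1975, Thm. 1] -/
theorem baker_gill_solovay_eq_holds : baker_gill_solovay_eq :=
  BGS.exists_computable_oracle_PRel_eq_NPRel

/-! ### The discharge of pnp.S17 (second half) -/

/-- **Discharge of `baker_gill_solovay_ne`** (pnp.S17, second half; Baker–Gill–Solovay 1975,
Thm. 3: "there is a recursive oracle `B` with `P^B ≠ NP^B`"; Homer–Selman 2011, Thm. 7.19: "There
exists a decidable set `A` such that `NP^A ≠ P^A`"). The oracle is the diagonalizing stage
construction `BGS.Dec.oracleB` (`BakerGillSolovayRecursiveB.lean`) with the least choices of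
Homer–Selman's proof — at stage `i`, the least fresh length `n` above the frozen bound with
`qᵢ(n) < 2ⁿ`, a run of `Mᵢ` on `1ⁿ` for `qᵢ(n)` rounds against the finite table built so far, and,
if it rejects, the first unqueried `⟨1ⁿ, y⟩`, `|y| = n`, put into `B` — over the standard
enumeration `BGS.stdPairEnum` of (oracle algorithm, polynomial clock) pairs (clocked standard `TM2`
machines run by a primitive recursive interpreter, paired with coefficient lists): the enumeration
contains every (polynomial-time oracle algorithm, polynomial) pair, so `U_B ∈ NP^B ∖ P^B`
(`BGS.Dec.PRel_ne_NPRel`), and it is uniformly primitive recursive, so the stages are computable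
and `B` is recursive (`BGS.Dec.computablePred_mem_oracleB`: membership of `s` is settled at stage
`|s| + 1`). Axioms: `propext`, `Classical.choice`, `Quot.sound`.
[cite: BakerGillSolovay1975, Thm. 3] [cite: HomerSelman2011, Thm. 7.19] -/
theorem baker_gill_solovay_ne_holds : baker_gill_solovay_ne :=
  BGS.exists_computable_oracle_PRel_ne_NPRel

end Literature.Computability.Complexity
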